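import Summits.NavierStokesRegularity.FunctionalMining.MiddleEigenvalueMomentDoor
import HarnessLib

/-!
# The K1-Q2 door, II: the 2.5D structural zero (§ 6) and the door for every real exponent `q ≥ 2` (§ 7)

Search for candidate a priori estimates; no regularity claim. Part 2/2 of the dictionary seat's staged
`pub-nsfunc-dict/MiddleEigenDoor.lean` v3 (32af055a5383d74c; split by the prove seat for the 400-line cap, text verbatim;
see the module docstring of part 1 `FunctionalMining/MiddleEigenvalueMomentDoor.lean` for the full account).
§ 6: `torusStretchingDensity_eq_neg_four_mul_det_of_vertical` (C¹ div-free on T³ with ∂₂v = 0 ⇒ σ = −4 det S pointwise),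
`weightedStretching_nonpos_of_vertical`, `not_killAll_hypotheses_of_vertical`. § 7: `MiddleEigenvalueStretchingStaticReal`,
`middleEigenvalueMomentRateBound_iff_staticReal` (every real q ≥ 2), the certificate format
`not_middleEigenvalueMomentRateBound_of_staticReal_violation`, `middleEigenvalueMomentRateFailsReal_of_nonpos_middle`.
[ours — internal, unreviewed]
-/

noncomputable section

open Set MeasureTheory Finset
open scoped InnerProductSpace RealInnerProductSpace

namespace Summit.NavierStokesRegularity.FunctionalMining

open Literature.Analysis Literature.Analysis.FunctionSpaces Literature.Analysis.FunctionSpaces.Torus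
  Literature.Analysis.FluidPDE

variable {d : Type*} [Fintype d] [DecidableEq d]

/-! ## 6. A structural zero of the K1-Q2 search: the 2.5D class (a POINTWISE Betchov relation)

For a `C¹` divergence-free field on `T³` that does not vary along the third coordinate direction
(`∂₂v ≡ 0`; "2.5D": a planar flow `(v₀, v₁)(x₀, x₁)` carrying a passive third component
`v₂(x₀, x₁)`), the stretching density and the strain determinant are proportional POINTWISE:
`σ(x) = −4 det S(x)` (for general three-dimensional fields only the INTEGRATED identity
`∫σ = −4∫det S` holds — Betchov 1956; here `ω_h = ∇^⊥v₂` is stretched by the planar strain `S_h`,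
`σ = ω_hᵀ S_h ω_h = −(∇v₂)ᵀ S_h ∇v₂ = −4 det S`). Since for a real symmetric trace-free `3 × 3`
matrix `0 ≤ det S ⟺ λ₂(S) ≤ 0` (decreasing eigenvalues `λ₁ ≥ λ₂ ≥ λ₃`, `det = λ₁λ₂λ₃`,
`λ₁ + λ₂ + λ₃ = 0`), in the 2.5D class `σ(x) ≤ 0` holds EXACTLY where `λ₂(S(x)) ≤ 0`. Consequence
for the no-go ascent: a field with `λ₂ ≤ 0` everywhere and positive weighted stretching
`∫|ω|^{2(m−1)}σ > 0` — the kill-all certificate of `middleEigenvalueMomentRateFails_of_nonpos_middle` —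
is NEVER 2.5D (`weightedStretching_nonpos_of_vertical`); the search must use genuinely
three-dimensional fields (pointwise, the axisymmetric strain `diag(s, −s/2, −s/2)` with `ω ∥ e₀` has
`det S = s³/4 > 0`, i.e. `λ₂ < 0`, and `ωᵀSω = s|ω|² > 0`: Burgers-type tube-in-axial-strain
configurations are the natural candidates). Search for candidate a priori estimates; no regularity
claim. [ours; elementary] -/

/-- **`0 ≤ det M ⟺ λ₂(M) ≤ 0`** for a real symmetric trace-free matrix over an index type with three
elements (`λ₂ = eigenvalues₀ 1`, the middle one of Mathlib's decreasingly sorted eigenvalues; same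
convention as `MiddleEigenvalueMomentRateBound` and Miller's Lemma 5.1 in the tree). Proof:
`det = λ₁λ₂λ₃`, `λ₁ + λ₂ + λ₃ = 0`, `λ₁ ≥ λ₂ ≥ λ₃`. [folklore] -/
theorem det_nonneg_iff_middleEigenvalue_nonpos {n : Type*} [Fintype n] [DecidableEq n]
    (hn : Fintype.card n = 3) (M : Matrix n n ℝ) (hsym : M.IsSymm) (htr : M.trace = 0) :
    0 ≤ M.det ↔ (Matrix.isHermitian_iff_isSymm.mpr hsym).eigenvalues₀ (Fin.cast hn.symm 1) ≤ 0 := by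
  set hH : M.IsHermitian := Matrix.isHermitian_iff_isSymm.mpr hsym with hHdef
  set lam : Fin 3 → ℝ := fun a => hH.eigenvalues₀ (Fin.cast hn.symm a) with hlam
  have hE : ∀ f : ℝ → ℝ, ∑ i, f (hH.eigenvalues i) = ∑ a : Fin 3, f (lam a) := by
    intro f
    have h1 : ∑ i, f (hH.eigenvalues i) = ∑ k, f (hH.eigenvalues₀ k) :=
      Fintype.sum_equiv (Fintype.equivOfCardEq (Fintype.card_fin _)).symm _ _ (fun i => rfl)
    rw [h1]
    exact Fintype.sum_equiv (finCongr hn) _ _ (fun k => by simp [hlam, finCongr])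
  have hP : ∏ i, hH.eigenvalues i = ∏ a : Fin 3, lam a := by
    have h1 : ∏ i, hH.eigenvalues i = ∏ k, hH.eigenvalues₀ k :=
      Fintype.prod_equiv (Fintype.equivOfCardEq (Fintype.card_fin _)).symm _ _ (fun i => rfl)
    rw [h1]
    exact Fintype.prod_equiv (finCongr hn) _ _ (fun k => by simp [hlam, finCongr])
  have hdet : M.det = ∏ a : Fin 3, lam a := by
    have := hH.det_eq_prod_eigenvalues
    simp only [RCLike.ofReal_real_eq_id, id_eq] at this
    rw [this, hP]
  have htr' : ∑ a : Fin 3, lam a = 0 := by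
    have := hH.trace_eq_sum_eigenvalues
    simp only [RCLike.ofReal_real_eq_id, id_eq] at this
    rw [← hE (fun x => x), ← this, htr]
  have hanti : Antitone lam := fun a b hab =>
    hH.eigenvalues₀_antitone ((Fin.cast_le_cast hn.symm).mpr hab)
  have h10 : lam 1 ≤ lam 0 := hanti (by decide)
  have h21 : lam 2 ≤ lam 1 := hanti (by decide)
  show 0 ≤ M.det ↔ lam 1 ≤ 0
  rw [hdet]
  simp only [Fin.sum_univ_three, Fin.prod_univ_three] at htr' ⊢
  constructor
  · intro h0
    by_contra h1
    have h1' : 0 < lam 1 := lt_of_not_ge h1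
    have h0' : 0 < lam 0 := lt_of_lt_of_le h1' h10
    have h2' : lam 2 < 0 := by linarith
    have : lam 0 * lam 1 * lam 2 < 0 := mul_neg_of_pos_of_neg (mul_pos h0' h1') h2'
    linarith
  · intro h1
    have h2 : lam 2 ≤ 0 := le_trans h21 h1
    have h0 : 0 ≤ lam 0 := by linarith
    have h12 : 0 ≤ lam 1 * lam 2 := mul_nonneg_of_nonpos_of_nonpos h1 h2
    have : 0 ≤ lam 0 * (lam 1 * lam 2) := mul_nonneg h0 h12
    linarith [show lam 0 * lam 1 * lam 2 = lam 0 * (lam 1 * lam 2) by ring]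

/-- The strain matrix `Sᵢⱼ = ½((∂ⱼv)ᵢ + (∂ᵢv)ⱼ)` is symmetric. [folklore] -/
theorem strainMatrix_isSymm (v : UnitAddTorus d → EuclideanSpace ℝ d) (x : UnitAddTorus d) :
    (Matrix.of fun i j => (Torus.partialDeriv j v x i + Torus.partialDeriv i v x j) / 2).IsSymm :=
  Matrix.IsSymm.ext fun i j => by simp only [Matrix.of_apply]; ring

/-- The strain matrix of a `C¹` divergence-free field is trace-free: `tr S = div v = 0`. [folklore] -/
theorem strainMatrix_trace_eq_zero {v : UnitAddTorus d → EuclideanSpace ℝ d}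
    (hv : Torus.IsContDiff 1 v) (hdiv : Torus.IsDivFree v) (x : UnitAddTorus d) :
    (Matrix.of fun i j => (Torus.partialDeriv j v x i + Torus.partialDeriv i v x j) / 2).trace = 0 := by
  have hsum : ∑ a, Torus.partialDeriv a v x a = 0 := by
    rw [← Torus.divergence_eq_sum_partialDeriv_apply hv x]; exact hdiv x
  simp only [Matrix.trace, Matrix.diag, Matrix.of_apply, add_self_div_two]
  exact hsum

/-- **Pointwise Betchov relation in the 2.5D class.** For a `C¹` divergence-free field on `T³`
with `∂₂v(x) = 0` (all components) at the point `x`: `σ(x) = −4 det S(x)`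
(`σ = torusStretchingDensity v x = ωᵀSω`, `S = ½((∂ⱼv)ᵢ + (∂ᵢv)ⱼ)`). With `a = (∂₀v)₀ = −(∂₁v)₁`,
`b = S₀₁`, `g = ∇v₂`: `ω = (g₁, −g₀, ω₂)`, `S₂₂ = 0`, `(S₀₂, S₁₂) = g/2`, and both sides equal
`−(a g₀² + 2b g₀g₁ − a g₁²)`. [ours; elementary] -/
theorem torusStretchingDensity_eq_neg_four_mul_det_of_vertical
    {v : UnitAddTorus (Fin 3) → EuclideanSpace ℝ (Fin 3)} (hv : Torus.IsContDiff 1 v)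
    (hdiv : Torus.IsDivFree v) {x : UnitAddTorus (Fin 3)}
    (h2 : ∀ k, Torus.partialDeriv 2 v x k = 0) :
    torusStretchingDensity v x =
      -4 * (Matrix.of fun i j : Fin 3 =>
        (Torus.partialDeriv j v x i + Torus.partialDeriv i v x j) / 2).det := by
  have hsum : ∑ a, Torus.partialDeriv a v x a = 0 := by
    rw [← Torus.divergence_eq_sum_partialDeriv_apply hv x]; exact hdiv x
  have h11 : Torus.partialDeriv 1 v x 1 = -Torus.partialDeriv 0 v x 0 := by
    simp only [Fin.sum_univ_three, h2 2, add_zero] at hsum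
    linarith
  set w : Fin 3 → ℝ := ![Torus.partialDeriv 1 v x 2, -Torus.partialDeriv 0 v x 2,
    Torus.partialDeriv 0 v x 1 - Torus.partialDeriv 1 v x 0] with hw
  have hwa : ∀ a : Fin 3, torusVorticityTensor v (a + 1) (a + 2) x = w a := by
    intro a
    fin_cases a <;> simp [hw, torusVorticityTensor, h2]
  rw [torusStretchingDensity_fin_three_of_isDivFree hv hdiv x]
  simp_rw [hwa]
  simp only [Fin.sum_univ_three, Matrix.det_fin_three, Matrix.of_apply, hw, Matrix.cons_val_zero,
    Matrix.cons_val_one, Matrix.head_cons, Matrix.cons_val_two, Matrix.tail_cons, h2, h11]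
  ring

/-- **In the 2.5D class, `σ(x) ≤ 0` exactly where `λ₂(S(x)) ≤ 0`** (pointwise Betchov relation +
`0 ≤ det ⟺ λ₂ ≤ 0`). [ours; elementary] -/
theorem torusStretchingDensity_nonpos_iff_middle_nonpos_of_vertical (hd : Fintype.card (Fin 3) = 3)
    {v : UnitAddTorus (Fin 3) → EuclideanSpace ℝ (Fin 3)} (hv : Torus.IsContDiff 1 v)
    (hdiv : Torus.IsDivFree v) {x : UnitAddTorus (Fin 3)}
    (h2 : ∀ k, Torus.partialDeriv 2 v x k = 0)
    (hx : (Matrix.of fun i j : Fin 3 =>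
      (Torus.partialDeriv j v x i + Torus.partialDeriv i v x j) / 2).IsHermitian) :
    torusStretchingDensity v x ≤ 0 ↔ hx.eigenvalues₀ (Fin.cast hd.symm 1) ≤ 0 := by
  have key := det_nonneg_iff_middleEigenvalue_nonpos hd _ (strainMatrix_isSymm v x)
    (strainMatrix_trace_eq_zero hv hdiv x)
  rw [torusStretchingDensity_eq_neg_four_mul_det_of_vertical hv hdiv h2, ← key]
  constructor
  · intro h; linarith
  · intro h; linarith

/-- **No 2.5D kill-all certificate.** If a `C¹` divergence-free field on `T³` is 2.5D (`∂₂v ≡ 0`)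
and its middle strain eigenvalue is `≤ 0` everywhere, then every weighted stretching
`2m∫|ω|^{2(m−1)}σ` is `≤ 0` — so the positivity hypothesis of
`middleEigenvalueMomentRateFails_of_nonpos_middle` fails in the 2.5D class for every `m`: the K1-Q2
static ascent for `q = 4, 6, …` must leave the 2.5D class (cf. the planar/2.5D structural zeros of
the K1-Q2 row in the cell dictionary). Search for candidate a priori estimates; no regularity claim.
[ours; elementary] -/
theorem weightedStretching_nonpos_of_vertical (m : ℕ) (hd : Fintype.card (Fin 3) = 3)
    {v : UnitAddTorus (Fin 3) → EuclideanSpace ℝ (Fin 3)} (hv : Torus.IsContDiff 1 v)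
    (hdiv : Torus.IsDivFree v) (h2 : ∀ x k, Torus.partialDeriv 2 v x k = 0)
    (hΛ : ∀ x, ∀ hx : (Matrix.of fun i j : Fin 3 =>
        (Torus.partialDeriv j v x i + Torus.partialDeriv i v x j) / 2).IsHermitian,
        hx.eigenvalues₀ (Fin.cast hd.symm 1) ≤ 0) :
    2 * m * ∫ x, torusVorticitySqAt v x ^ (m - 1) * torusStretchingDensity v x ≤ 0 := by
  have hpt : ∀ x, torusVorticitySqAt v x ^ (m - 1) * torusStretchingDensity v x ≤ 0 := by
    intro x
    have hσ : torusStretchingDensity v x ≤ 0 :=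
      (torusStretchingDensity_nonpos_iff_middle_nonpos_of_vertical hd hv hdiv (h2 x)
        (Matrix.isHermitian_iff_isSymm.mpr (strainMatrix_isSymm v x))).mpr
        (hΛ x _)
    exact mul_nonpos_iff.mpr (Or.inl ⟨pow_nonneg (torusVorticitySqAt_nonneg v x) _, hσ⟩)
  have hint : ∫ x, torusVorticitySqAt v x ^ (m - 1) * torusStretchingDensity v x ≤ 0 :=
    integral_nonpos hpt
  exact mul_nonpos_iff.mpr (Or.inl ⟨by positivity, hint⟩)

/-- The same, phrased against `middleEigenvalueMomentRateFails_of_nonpos_middle`: its positivity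
hypothesis is unsatisfiable by 2.5D fields. [ours; elementary] -/
theorem not_killAll_hypotheses_of_vertical (m : ℕ) (hd : Fintype.card (Fin 3) = 3)
    {v : UnitAddTorus (Fin 3) → EuclideanSpace ℝ (Fin 3)} (hv : Torus.IsContDiff 1 v)
    (hdiv : Torus.IsDivFree v) (h2 : ∀ x k, Torus.partialDeriv 2 v x k = 0)
    (hΛ : ∀ x, ∀ hx : (Matrix.of fun i j : Fin 3 =>
        (Torus.partialDeriv j v x i + Torus.partialDeriv i v x j) / 2).IsHermitian,
        hx.eigenvalues₀ (Fin.cast hd.symm 1) ≤ 0) :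
    ¬ (0 < 2 * m * ∫ x, torusVorticitySqAt v x ^ (m - 1) * torusStretchingDensity v x) :=
  not_lt.mpr (weightedStretching_nonpos_of_vertical m hd hv hdiv h2 hΛ)


/-! ## 7. The door for every REAL exponent `q ≥ 2` (v3; literature p203993, p204166) -/

/-- **Static middle-eigenvalue stretching inequality at a REAL exponent `q` (K1-Q2, static form).**
For every smooth divergence-free `v` on `T³` and every `Λ ≥ 0` bounding the middle strain eigenvalue
pointwise (as in `MiddleEigenvalueMomentRateBound`):
`q ∫ (|ω|²)^{q/2−1} σ ≤ C · Λ · Z_q(v)`, `Z_q(v) = torusVorticityMoment q v = ∫(|ω|²)^{q/2}`,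
`σ = torusStretchingDensity v`. At `q = 2m` this is `MiddleEigenvalueStretchingStatic m C`
(`middleEigenvalueStretchingStaticReal_iff_even`). A static inequality between integrals of one field
— search for candidate a priori estimates; no regularity claim; nothing is asserted. [ours; typing] -/
@[conjecture] def MiddleEigenvalueStretchingStaticReal (q C : ℝ) : Prop :=
  ∀ hd : Fintype.card d = 3, ∀ v : UnitAddTorus d → EuclideanSpace ℝ d,
    Torus.IsSmooth v → Torus.IsDivFree v → ∀ Λ : ℝ, 0 ≤ Λ →
      (∀ x, ∀ hx : (Matrix.of fun i j =>
          (Torus.partialDeriv j v x i + Torus.partialDeriv i v x j) / 2).IsHermitian,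
          hx.eigenvalues₀ (Fin.cast hd.symm 1) ≤ Λ) →
      q * ∫ x, torusVorticitySqAt v x ^ (q / 2 - 1) * torusStretchingDensity v x ≤
        C * Λ * torusVorticityMoment q v

/-- Monotonicity of the real static form in the constant. [ours; elementary] -/
theorem MiddleEigenvalueStretchingStaticReal.mono {q C C' : ℝ}
    (h : MiddleEigenvalueStretchingStaticReal (d := d) q C) (hCC' : C ≤ C') :
    MiddleEigenvalueStretchingStaticReal (d := d) q C' := by
  intro hd v hv hdiv Λ hΛ0 hΛ
  exact (h hd v hv hdiv Λ hΛ0 hΛ).trans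
    (mul_le_mul_of_nonneg_right (mul_le_mul_of_nonneg_right hCC' hΛ0)
      (torusVorticityMoment_nonneg q v))

/-- **Real-`q` door, forward: static ⇒ dynamic** (`q ≥ 2`): every one-sided derivative `R` of `Z_q`
along a classical solution of unforced Navier–Stokes/Euler (`ν ≥ 0`) on `T³` obeys
`R ≤ q∫(|ω|²)^{q/2−1}σ` (Gibbon 2010 App. A for real moments; literature p203993) `≤ CΛZ_q`.
Search for candidate a priori estimates; no regularity claim. [ours] -/
theorem middleEigenvalueMomentRateBound_of_staticReal {q : ℝ} (hq : 2 ≤ q) {C : ℝ}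
    (h : MiddleEigenvalueStretchingStaticReal (d := d) q C) :
    MiddleEigenvalueMomentRateBound (d := d) q C := by
  intro hd ν hν a b hab u p hsol t ht Λ hΛ0 hΛ R hR
  have hR' : HasDerivWithinAt (fun s => ∫ x, torusVorticitySqAt (u s) x ^ (q / 2)) R (Icc a b) t :=
    hR
  have hle := hsol.deriv_integral_torusVorticitySqAt_rpow_le_of_two_le hν hab hq ht hR'
  have hst := h hd (u t) (hsol.smooth_velocity.isSmooth_slice ht) (hsol.divFree t ht) Λ hΛ0 hΛ
  exact hle.trans hst

/-- **Real-`q` door, backward: dynamic ⇒ static** (`q ≥ 2`): run the local classical EULER solution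
from the field (`Torus.exists_classicalNS_smooth` at `ν = 0`); at `t = 0` the exact derivative of
`Z_q` is `q∫(|ω|²)^{q/2−1}σ(v)` (literature p204166, `C¹` weight `s ↦ s^{q/2}`), and the law bounds
it by `CΛZ_q(v)`. Search for candidate a priori estimates; no regularity claim. [ours] -/
theorem MiddleEigenvalueMomentRateBound.staticReal {q : ℝ} (hq : 2 ≤ q) {C : ℝ}
    (h : MiddleEigenvalueMomentRateBound (d := d) q C) :
    MiddleEigenvalueStretchingStaticReal (d := d) q C := by
  intro hd v hv hdiv Λ hΛ0 hΛ
  obtain ⟨T, hT, u, p, hsol, hu0, -⟩ := Torus.exists_classicalNS_smooth (d := d) hd.le le_rfl hv hdiv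
  have h0 : (0 : ℝ) ∈ Icc 0 T := left_mem_Icc.2 hT.le
  have hder := hsol.hasDerivWithinAt_integral_torusVorticitySqAt_rpow_euler hT hq h0
  have hder2 : HasDerivWithinAt (fun s => torusVorticityMoment q (u s))
      (q * ∫ x, torusVorticitySqAt (u 0) x ^ (q / 2 - 1) * torusStretchingDensity (u 0) x)
      (Icc 0 T) 0 := hder
  have hΛ' : ∀ x, ∀ hx : (Matrix.of fun i j =>
      (Torus.partialDeriv j (u 0) x i + Torus.partialDeriv i (u 0) x j) / 2).IsHermitian,
      hx.eigenvalues₀ (Fin.cast hd.symm 1) ≤ Λ := by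
    rw [hu0]
    exact hΛ
  have hle := h hd le_rfl hT hsol 0 h0 Λ hΛ0 hΛ' _ hder2
  rw [hu0] at hle
  exact hle

/-- **The K1-Q2 door for every real `q ≥ 2`: dynamic law ⇔ static inequality.** Search for candidate
a priori estimates; no regularity claim. [ours] -/
theorem middleEigenvalueMomentRateBound_iff_staticReal {q : ℝ} (hq : 2 ≤ q) {C : ℝ} :
    MiddleEigenvalueMomentRateBound (d := d) q C ↔ MiddleEigenvalueStretchingStaticReal (d := d) q C :=
  ⟨fun h => h.staticReal hq, fun h => middleEigenvalueMomentRateBound_of_staticReal hq h⟩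

/-- Consistency with the even-moment door: at `q = 2m`, `m ≥ 1`, the real static form IS the
natural-power static form of § 2 (both are equivalent to the same dynamic law). [ours] -/
theorem middleEigenvalueStretchingStaticReal_iff_even {m : ℕ} (hm : 1 ≤ m) {C : ℝ} :
    MiddleEigenvalueStretchingStaticReal (d := d) (2 * m) C ↔
      MiddleEigenvalueStretchingStatic (d := d) m C := by
  have hq : (2 : ℝ) ≤ 2 * (m : ℝ) := by
    have : (1 : ℝ) ≤ m := by exact_mod_cast hm
    linarith
  rw [← middleEigenvalueMomentRateBound_iff_staticReal hq, middleEigenvalueMomentRateBound_iff_static hm]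

/-- **NO-GO CRITERION for K1-Q2 at a real exponent `q ≥ 2`.** One smooth divergence-free field `v` on
`T³`, one admissible `Λ ≥ 0` and the strict violation `C·Λ·Z_q(v) < q∫(|ω|²)^{q/2−1}σ` refute
`MiddleEigenvalueMomentRateBound q C` — the exact-lane / census door for ALL K0 rows `E.q|T_C|C3b` with
`q ≥ 2` (`q ∈ {5/2, 3, 10/3, 4, 5, 6}`). Search for candidate a priori estimates; no regularity claim.
[ours] -/
theorem not_middleEigenvalueMomentRateBound_of_staticReal_violation {q : ℝ} (hq : 2 ≤ q) {C : ℝ}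
    (hd : Fintype.card d = 3) {v : UnitAddTorus d → EuclideanSpace ℝ d} (hv : Torus.IsSmooth v)
    (hdiv : Torus.IsDivFree v) {Λ : ℝ} (hΛ0 : 0 ≤ Λ)
    (hΛ : ∀ x, ∀ hx : (Matrix.of fun i j =>
        (Torus.partialDeriv j v x i + Torus.partialDeriv i v x j) / 2).IsHermitian,
        hx.eigenvalues₀ (Fin.cast hd.symm 1) ≤ Λ)
    (hviol : C * Λ * torusVorticityMoment q v <
      q * ∫ x, torusVorticitySqAt v x ^ (q / 2 - 1) * torusStretchingDensity v x) :
    ¬ MiddleEigenvalueMomentRateBound (d := d) q C := fun h =>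
  absurd (h.staticReal hq hd v hv hdiv Λ hΛ0 hΛ) (not_le.mpr hviol)

/-- **Refutation of EVERY constant at a real exponent `q ≥ 2`**: a smooth divergence-free field on
`T³` with middle strain eigenvalue `≤ 0` everywhere and `q∫(|ω|²)^{q/2−1}σ > 0` kills
`MiddleEigenvalueMomentRateBound q C` for all `C`. Search for candidate a priori estimates; no
regularity claim. [ours] -/
theorem middleEigenvalueMomentRateFailsReal_of_nonpos_middle {q : ℝ} (hq : 2 ≤ q)
    (hd : Fintype.card d = 3) {v : UnitAddTorus d → EuclideanSpace ℝ d} (hv : Torus.IsSmooth v)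
    (hdiv : Torus.IsDivFree v)
    (hΛ : ∀ x, ∀ hx : (Matrix.of fun i j =>
        (Torus.partialDeriv j v x i + Torus.partialDeriv i v x j) / 2).IsHermitian,
        hx.eigenvalues₀ (Fin.cast hd.symm 1) ≤ 0)
    (hpos : 0 < q * ∫ x, torusVorticitySqAt v x ^ (q / 2 - 1) * torusStretchingDensity v x) :
    ∀ C : ℝ, ¬ MiddleEigenvalueMomentRateBound (d := d) q C := fun C =>
  not_middleEigenvalueMomentRateBound_of_staticReal_violation hq hd hv hdiv le_rfl hΛ
    (by simpa using hpos)

/-- **Calibration at `q = 2` through the real door**: `MiddleEigenvalueStretchingStaticReal 2 2`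
(`2∫(|ω|²)⁰σ ≤ 2Λ Z₂`, Betchov–Miller) from the tree's dynamic theorem
`middleEigenvalueMomentRateBound_two`. [folklore; ours as a corollary] -/
theorem middleEigenvalueStretchingStaticReal_two :
    MiddleEigenvalueStretchingStaticReal (d := d) 2 2 :=
  (middleEigenvalueMomentRateBound_two (d := d)).staticReal le_rfl

/-- **No 2.5D kill-all certificate, real weights**: for a `C¹` divergence-free 2.5D field on `T³`
(`∂₂v ≡ 0`) with middle strain eigenvalue `≤ 0` everywhere, `q∫(|ω|²)^{q/2−1}σ ≤ 0` for every
`q ≥ 0` (pointwise `σ = −4 det S ≤ 0`, § 6). Search for candidate a priori estimates; no regularity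
claim. [ours; elementary] -/
theorem weightedStretchingReal_nonpos_of_vertical {q : ℝ} (hq : 0 ≤ q)
    (hd : Fintype.card (Fin 3) = 3)
    {v : UnitAddTorus (Fin 3) → EuclideanSpace ℝ (Fin 3)} (hv : Torus.IsContDiff 1 v)
    (hdiv : Torus.IsDivFree v) (h2 : ∀ x k, Torus.partialDeriv 2 v x k = 0)
    (hΛ : ∀ x, ∀ hx : (Matrix.of fun i j : Fin 3 =>
        (Torus.partialDeriv j v x i + Torus.partialDeriv i v x j) / 2).IsHermitian,
        hx.eigenvalues₀ (Fin.cast hd.symm 1) ≤ 0) :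
    q * ∫ x, torusVorticitySqAt v x ^ (q / 2 - 1) * torusStretchingDensity v x ≤ 0 := by
  have hpt : ∀ x, torusVorticitySqAt v x ^ (q / 2 - 1) * torusStretchingDensity v x ≤ 0 := by
    intro x
    have hσ : torusStretchingDensity v x ≤ 0 :=
      (torusStretchingDensity_nonpos_iff_middle_nonpos_of_vertical hd hv hdiv (h2 x)
        (Matrix.isHermitian_iff_isSymm.mpr (strainMatrix_isSymm v x))).mpr
        (hΛ x _)
    exact mul_nonpos_iff.mpr
      (Or.inl ⟨Real.rpow_nonneg (torusVorticitySqAt_nonneg v x) _, hσ⟩)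
  exact mul_nonpos_iff.mpr (Or.inl ⟨hq, integral_nonpos hpt⟩)

/-- The same, phrased against `middleEigenvalueMomentRateFailsReal_of_nonpos_middle`: its positivity
hypothesis is unsatisfiable by 2.5D fields (every real `q ≥ 0`). [ours; elementary] -/
theorem not_killAllReal_hypotheses_of_vertical {q : ℝ} (hq : 0 ≤ q) (hd : Fintype.card (Fin 3) = 3)
    {v : UnitAddTorus (Fin 3) → EuclideanSpace ℝ (Fin 3)} (hv : Torus.IsContDiff 1 v)
    (hdiv : Torus.IsDivFree v) (h2 : ∀ x k, Torus.partialDeriv 2 v x k = 0)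
    (hΛ : ∀ x, ∀ hx : (Matrix.of fun i j : Fin 3 =>
        (Torus.partialDeriv j v x i + Torus.partialDeriv i v x j) / 2).IsHermitian,
        hx.eigenvalues₀ (Fin.cast hd.symm 1) ≤ 0) :
    ¬ (0 < q * ∫ x, torusVorticitySqAt v x ^ (q / 2 - 1) * torusStretchingDensity v x) :=
  not_lt.mpr (weightedStretchingReal_nonpos_of_vertical hq hd hv hdiv h2 hΛ)

end Summit.NavierStokesRegularity.FunctionalMining

end
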